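import Summits.FinalStateConjecture.FinalStateConjecture.Theses.DerivativeThrift
import Summits.FinalStateConjecture.FinalStateConjecture.Theses.StarvedNecks
import Summits.FinalStateConjecture.FinalStateConjecture.Theorems.StarvedNecksSeamedChartsExhaust
import Summits.FinalStateConjecture.FinalStateConjecture.Theorems.StarvedNecksFutureOrientedOfSeamed
import Summits.FinalStateConjecture.FinalStateConjecture.Theorems.DerivativeThriftThriftyClusterSettlingSplitting
import HarnessLib.Audit

/-!
# Skeleton v4 (lead c9 reshape of v3, 2026-08-17) — crux `DerivativeThrift.ThriftyClusterSettling`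
# (stmt-FinalStateConjecture-17611), line `registered` (born `Lines/birth.lean`, BC3; v2/v3 by lead c1)

The crux is FIXED and concluded BY NAME (`ThriftyClusterSettling_of` below):

  `Summit.FinalStateConjecture.FinalStateConjecture.Theses.DerivativeThrift.ThriftyClusterSettling`
  `:= ThriftyKerrStability → ∀ admissible D, MGHD 𝒟, complete 𝓘⁺, (thrifty N-hole hand-over) →`
  `   ∃ O d, sub-extremal ∧ O = exteriorOf 𝒟 d.charted ∧ HasExhaustiveCharts d ∧ IsFutureOriented d`.

## What v4 changes with respect to v3 (sha a3538514…, stubs `stub_thriftySeamedAtlas`, `stub_outerZoneFlatness`)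

v3's `stub_outerZoneFlatness : ∀ admissible D, MGHD 𝒟, complete 𝓘⁺ → OuterFlatness 𝒟` is MISSTATED AS TYPED
(item notes c1/c6, `Lines/registered-promote-c7.md`: it is STRICTLY STRONGER than anything the crux forces — it
drops the two hypotheses `ThriftyKerrStability` and the thrifty hand-over that the crux has in scope at that point —
and it is refuted on paper pointwise in the admissible `o₂(r⁻¹)` class by far-field focusing packets).  Per the line
protocol (L4: a misstated stub is RESHAPED by the lead) v4 replaces the v3 pair by the TIGHT pair certified in kernel
by `Theorems.DerivativeThrift.ThriftyClusterSettling.thriftyClusterSettling_iff_repairA_and_forcedOuterFlatness`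
(p153616, lead c4):

* `stub_repairA` — the crux WITH the outer-zone flatness certificate added to its antecedent (the registrar's
  Repair A; the INTENDED content of the item: receding decoupling + exhaustive bookkeeping granted TKS; open
  problem, crux-sized).  Weaker than v3's `stub_thriftySeamedAtlas` (it asks for the consequent, not for the
  StarvedNecks `SeamedAtlas` certificate); the v3 route to it is kept below as the proved reduction
  `repairA_of_seamedAtlasRoute` (seamed atlas ⊕ landed packaging p145999 ⇒ `stub_repairA`).
* `stub_forcedOuterFlatness` — `ThriftyKerrStability →` every MGHD of admissible data with complete `𝓘⁺` AND a
  thrifty hand-over is outer-flat: exactly the conjunct of the crux that no hypothesis feeds (v3's stub 2 with the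
  two in-scope hypotheses restored).  Paper status (dossiers c1–c8): under `ThriftyKerrStability` as filed (k = 2) it
  is refuted pointwise by focusing packets; the same packets refute `ThriftyKerrStability` as filed, under which
  reading the stub (and the whole crux, hinge p159766) holds VACUOUSLY — either way it is not worth an item, and
  the recorded repair is to RESTATE the crux as Repair A/B with k := 3 (`Lines/registered_restatement_c4.lean`).

Both v4 stubs are NECESSARY — each is implied by the crux, BY NAME, in kernel (`stub_repairA_necessary`,
`stub_forcedOuterFlatness_necessary`, from p153616's projections) — and jointly SUFFICIENT (`crux_iff_stubSigs`,
`ThriftyClusterSettling_of`).  So v4 is an exact splitting of the item as filed: no registered stub is stronger than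
the crux needs, and `crux ↔ stub_repairA ∧ stub_forcedOuterFlatness`.  Closability is UNCHANGED by the reshape
(lean check: sorries 2 = the two stubs): `stub_repairA` is the open problem proper (and, as typed, TKS is idle in it
for N ≠ 1 — `Lines/registered-stuck-c8.md` §2(b)); `stub_forcedOuterFlatness` needs either `¬ ThriftyKerrStability`
in kernel (a constructed non-settling thrifty MGHD — not constructible in this tree) or an outer-zone theorem for the
whole admissible class that is false on paper.  The stub signatures are written in TREE vocabulary
(`Theorems.DerivativeThriftThriftyHandoff.FullHandoff`, the outer certificate unfolded) token-identically to the two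
conjuncts of p153616, so a worker's `--supports` file can state them without importing this workfile; the v3 names
`ThriftyHandover` / `OuterFlatness` / `SeamedAtlas` are kept as documentation and are definitionally the same texts
(`thriftyHandover_iff_fullHandoff`, `outerFlatness_iff`, both `Iff.rfl`).

Disproof used: none exists for this crux (no `Cruxes/ThriftyClusterSettling/Disproof.lean`, 2026-08-17T14:4xZ).
Landed kernel facts this skeleton leans on (all accepted, `--supports` 17611): p145999 (packaging stub 3'),
p150580 (consequent ⇒ outer flatness), p153616 (splitting), p155684 (trivial fibre: both stubs' bodies hold at the
Minkowski datum), p159766 (hinge: `¬TKS ⊢ crux`, `¬crux ⊢ TKS`), p151567 (`¬crux` modulo `TKS ∧` a non-outer-flat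
thrifty MGHD).  No stub restates the crux, `ThriftyKerrStability`, the summit, or a refuted statement.
-/

noncomputable section

open scoped Manifold ContDiff Topology ENNReal
open Filter Set TopologicalSpace Literature.Geometry.Lorentzian

namespace Summit.FinalStateConjecture.FinalStateConjecture.Cruxes.ThriftyClusterSettling.Registered

set_option linter.dupNamespace false
set_option linter.unusedVariables false

variable {X : Type} [TopologicalSpace X] [ChartedSpace E3 X] [IsManifold (𝓡 3) ∞ X]
  [ConnectedSpace X] {D : InitialDataSet (𝓡 3) X}

/-! ## The crux's antecedent, named (token-identical to the route decl and to the tree's `FullHandoff`) -/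

/-! ## The crux's antecedent, named (token-identical to the route decl) -/

/-- **The thrifty `N`-hole hand-over of the MGHD `𝒟`** — verbatim the antecedent of
`Theses.DerivativeThrift.ThriftyClusterSettling` (and conjunct (iii) of `ThriftyHandoff`): `N`,
sub-extremal labels, orthochronous Lorentz motions with pairwise distinct 3-velocities, and for every
scale `ℓ > 0`, accuracy `ε > 0` and `τ₁` a lab time `τ ≥ τ₁`, separating non-approaching centres and a
smooth open embedding of the `N`-hole layer with image in `J⁺(ι X)`, achronal leaves and
`𝔑_(2,1/2,1/2) ≤ ε`. -/
def ThriftyHandover (𝒟 : VacuumCauchyDevelopment D) : Prop :=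
  ∃ (N : ℕ) (M a : Fin N → ℝ) (Λ : Fin N → ↥lorentzGroup),
    (∀ i, Kerr.IsSubextremal (M i) (a i)) ∧ (∀ i, IsOrthochronous (Λ i)) ∧
    (∀ i j, i ≠ j →
      (((Λ i : E4 ≃L[ℝ] E4) (E4.basisVector 0)) 0)⁻¹ •
          E4.spatial ((Λ i : E4 ≃L[ℝ] E4) (E4.basisVector 0)) ≠
        (((Λ j : E4 ≃L[ℝ] E4) (E4.basisVector 0)) 0)⁻¹ •
          E4.spatial ((Λ j : E4 ≃L[ℝ] E4) (E4.basisVector 0))) ∧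
    ∀ ℓ : ℝ, 0 < ℓ → ∀ ε : ℝ, 0 < ε → ∀ τ₁ : ℝ, ∃ τ : ℝ, τ₁ ≤ τ ∧
      ∃ (ξ : Fin N → E3) (Φ : RecedingKerr.layer M a Λ ξ τ ℓ → 𝒟.carrier),
        (∀ i j, i ≠ j → ε⁻¹ ≤ ‖ξ i - ξ j‖ ∧
          0 ≤ @inner ℝ E3 _ (ξ i - ξ j)
            ((((Λ i : E4 ≃L[ℝ] E4) (E4.basisVector 0)) 0)⁻¹ •
                E4.spatial ((Λ i : E4 ≃L[ℝ] E4) (E4.basisVector 0)) -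
              (((Λ j : E4 ≃L[ℝ] E4) (E4.basisVector 0)) 0)⁻¹ •
                E4.spatial ((Λ j : E4 ≃L[ℝ] E4) (E4.basisVector 0)))) ∧
        ContMDiff 𝓘(ℝ, E4) (𝓡 4) ((⊤ : ℕ∞) : WithTop ℕ∞) Φ ∧ Topology.IsOpenEmbedding Φ ∧
        Set.range Φ ⊆ 𝒟.metric.causalFuture 𝒟.timeOrientation (Set.range 𝒟.embed) ∧
        (∀ s₀ ∈ Set.Ioo 0 ℓ, 𝒟.metric.IsAchronal 𝒟.timeOrientation
          (Φ '' {x | RecedingKerr.layerTime τ ℓ x.1 = s₀})) ∧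
        𝒟.toSpacetime.recedingKerrInitialLayerNorm M a Λ ξ τ ℓ 2 (1 / 2) (1 / 2) Φ ≤
          ENNReal.ofReal ε

/-! ## The two intermediate certificates of the intended proof of stub A (v3 vocabulary, kept) -/

/-- **Seamed atlas of `𝒟`** — the output of the analytic stub and the input of the packaging lemma:
the StarvedNecks certificate shape VERBATIM.  A region `O`, a `C²` final-state decomposition `d` of
`O` (hence already: `N` boosted-Kerr near-zone charts with truncated `C²` convergence for every radius,
separation, sublinear tubes, ONE flat chart on the late half-space minus the tubes with full-slab `C²`
convergence, the global covering clause), radii `R : Fin d.N → ℝ → ℝ` and `R₀ : ℝ`, with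
`O = exteriorOf 𝒟 d.charted`, HonestCore(`d`, `R₀`) — sub-extremal holes, `100 Mᵢ ≤ R₀`, orthochronous
motions; hole-late points of `{r < ϱ}` causally below every later disc; relatively closed late tube
portions; `∂₀` future-directed on the late flat domain — and SEAMED(`d`, `R`, `R₀`) — monotone
continuous radii `Rᵢ ≥ R₀ + 4`, flat tubes `ρᵢ ≥ R₀`; `C²` certification of each hole chart out to
`Rᵢ(τ)`; `C⁰` thresholds `1/10` (flat) and `1/(10‖Λᵢ‖²)` (holes); future-directed hole time-lines on
the certified tubes; ONE ATLAS `Ψᵢ = Φ` outside the flat tubes within `Rᵢ + 1`; flat-late domain = tube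
complement; flat tubes deep inside certified tubes; hole clocks `≤` flat clock; far hole leaves in the
radiation zone; closure of the flat-late image; certified tubes of distinct holes disjoint.  The clause
families `Hc`/`Sm` are the texts of `Theses.StarvedNecks.SeamedChartsExhaust` (= those of
`…FutureOrientedOfSeamed`) token-identically (copied, not imported: they are `let`-bound there).
DHRT arXiv:2104.08222, §1; O'Neill 1983, Ch. 14. -/
def SeamedAtlas (𝒟 : VacuumCauchyDevelopment D) : Prop :=
  let Hc := ( fun (𝓢 : Spacetime.{0} 4) (O : Set 𝓢.carrier) (k : ℕ) (d : FinalStateDecomposition 𝓢 O k) (R₀ : ℝ) => let B := d.background; let t := fun i ↦ (B i).time; let r := fun i ↦ (B i).radius; let Ψ := d.chart; (∀ i, Kerr.IsSubextremal (d.mass i) (d.spin i) ∧ 100 * d.mass i ≤ R₀ ∧ 0 < ((d.motion i).1 : E4 ≃L[ℝ] E4) (E4.basisVector 0) 0) ∧ (∀ i (ϱ τ₂ : ℝ), R₀ ≤ ϱ → d.τ₀ < τ₂ → Ψ i '' {x | d.τ₀ < t i x.1 ∧ t i x.1 < τ₂ ∧ r i x.1 < ϱ} ⊆ 𝓢.metric.causalPast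 𝓢.timeOrientation (Ψ i '' (B i).truncTimeSlab ϱ τ₂)) ∧ (∀ i (τ' : ℝ) (ϱ : ℝ → ℝ), Continuous ϱ → d.τ₀ < τ' → let A := Ψ i '' {x | τ' ≤ t i x.1 ∧ r i x.1 ≤ ϱ (t i x.1)}; closure A ∩ O ⊆ A) ∧ (∀ y : d.flatDomain, d.τ₀ < y.1 0 → 𝓢.timeOrientation.IsFutureDirected (mfderiv 𝓘(ℝ, E4) (𝓡 4) d.flatChart y (E4.basisVector 0))) ); let Sm := ( fun (𝓢 : Spacetime.{0} 4) (O : Set 𝓢.carrier) (d : FinalStateDecomposition 𝓢 O 2) (R : Fin d.N → ℝ → ℝ) (R₀ : ℝ) => let B := d.background; let t := fun i ↦ (B i).time; let r := fun i ↦ (B i).radius; let Λ := fun i ↦ ((d.motion i).1 : E4 ≃L[ℝ] E4); let Φ := d.flatChart; let Ψ := d.chart; let ρ := d.excision; (∀ i, Monotone (R i) ∧ Continuous (R i) ∧ ∀ s, R₀ + 4 ≤ R i s ∧ R₀ ≤ ρ i s) ∧ (∀ i, Tendsto (fun τ ↦ 𝓢.truncDeviationCk (B i) (Ψ i) 2 (R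 i τ) τ) atTop (𝓝 0)) ∧ supCkENorm (Subtype.val '' {y : d.flatDomain | d.τ₀ ≤ y.1 0}) 0 (𝓢.deviationExtend (Minkowski.backgroundOn d.flatDomain) Φ) ≤ 10⁻¹ ∧ (∀ i, supCkENorm (Subtype.val '' {x : (B i).domain | (d.τ₀ ≤ t i x.1 ∨ d.τ₀ ≤ x.1 0) ∧ R₀ ≤ r i x.1 ∧ r i x.1 ≤ R i (t i x.1)}) 0 (𝓢.deviationExtend (B i) (Ψ i)) ≤ ENNReal.ofReal (1 / (10 * ‖(Λ i : E4 →L[ℝ] E4)‖ ^ 2))) ∧ (∀ i (x : (B i).domain), (d.τ₀ ≤ t i x.1 ∨ d.τ₀ ≤ x.1 0) → R₀ ≤ r i x.1 → r i x.1 ≤ R i (t i x.1) → 𝓢.timeOrientation.IsFutureDirected (mfderiv 𝓘(ℝ, E4) (𝓡 4) (Ψ i) x ((Λ i) (E4.basisVector 0)))) ∧ (∀ i (y : E4) (hy : y ∈ (B i).domain), d.τ₀ ≤ y 0 → (∀ j, ρ j (y 0) < r j y) → r i y ≤ R i (t i y) + 1 → ∃ hy' : y ∈ d.flatDomain, Ψ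 i ⟨y, hy⟩ = Φ ⟨y, hy'⟩) ∧ (∀ y : d.flatDomain, d.τ₀ ≤ y.1 0 → ∀ j, ρ j (y.1 0) < r j y.1) ∧ (∀ j (y : E4), d.τ₀ ≤ y 0 → r j y ≤ ρ j (y 0) → r j y + 2 ≤ R j (t j y)) ∧ (∀ j (y : E4), d.τ₀ ≤ t j y → r j y ≤ R j (t j y) + 2 → t j y ≤ y 0) ∧ (∀ j, Ψ j '' {x | d.τ₀ < t j x.1 ∧ R j (t j x.1) + 1 < r j x.1} ⊆ d.radiationZone) ∧ (∀ τ' : ℝ, d.τ₀ < τ' → closure (Φ '' {y | τ' ≤ y.1 0}) ⊆ Φ '' {y | τ' ≤ y.1 0} ∪ ⋃ j, Ψ j '' {x | τ' ≤ x.1 0 ∧ r j x.1 = ρ j (x.1 0)}) ∧ (∀ j j' (y : E4), j ≠ j' → (d.τ₀ ≤ y 0 ∨ d.τ₀ ≤ t j y) → r j y ≤ R j (t j y) + 1 → R j' (t j' y) + 1 < r j' y) ); ∃ (O : Set 𝒟.carrier) (d : FinalStateDecomposition 𝒟.toSpacetime O 2) (R : Fin d.N → ℝ → ℝ) (R₀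 : ℝ), O = exteriorOf 𝒟.toCauchyDevelopment d.charted ∧ Hc 𝒟.toSpacetime O 2 d R₀ ∧ Sm 𝒟.toSpacetime O d R R₀

/-- **Outer-zone flatness of `𝒟`** — the input no hypothesis of the crux feeds: for some aperture
`θ > 0`, a late flat chart `Φₑ` on `V ⊇ {x⁰ > τₑ, |x̲| > (1 − θ) x⁰}` (old-radiation band, `i⁰` corner and
far wave zone), a late chart into `J⁺(ι X)`, with full-slab sup-`C²` deviation from `η` tending to `0`
and `∂₀` eventually future-directed.  A cone COMPLEMENT (band of width `θ x⁰` against the inner cone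
`|x̲| < x⁰ − u₀`) so that the seam with an inner atlas survives `o(x⁰)` drift and rate-free convergence. -/
def OuterFlatness (𝒟 : VacuumCauchyDevelopment D) : Prop :=
  ∃ (θ τₑ : ℝ) (V : TopologicalSpace.Opens E4) (Φₑ : V → 𝒟.carrier), 0 < θ ∧
    {x : E4 | τₑ < x 0 ∧ (1 - θ) * x 0 < E4.spatialNorm x} ⊆ (V : Set E4) ∧
    𝒟.toSpacetime.IsLateChart (Minkowski.backgroundOn V)
      (𝒟.metric.causalFuture 𝒟.timeOrientation (Set.range 𝒟.embed)) τₑ Φₑ ∧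
    Tendsto (fun τ ↦ 𝒟.toSpacetime.deviationCk (Minkowski.backgroundOn V) Φₑ 2 τ) atTop (𝓝 0) ∧
    ∀ᶠ τ in atTop, ∀ x ∈ (Minkowski.backgroundOn V).timeSlab τ,
      𝒟.timeOrientation.IsFutureDirected (mfderiv 𝓘(ℝ, E4) (𝓡 4) Φₑ x (E4.basisVector 0))

/-- The skeleton's `ThriftyHandover` IS the tree's `Theorems.DerivativeThriftThriftyHandoff.FullHandoff`
(token-identical texts; definitional). -/
theorem thriftyHandover_iff_fullHandoff (𝒟 : VacuumCauchyDevelopment D) :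
    ThriftyHandover 𝒟 ↔ Theorems.DerivativeThriftThriftyHandoff.FullHandoff 𝒟 :=
  Iff.rfl

/-- The skeleton's `OuterFlatness` IS the unfolded outer-zone certificate of p150580/p153616 (definitional). -/
theorem outerFlatness_iff (𝒟 : VacuumCauchyDevelopment D) :
    OuterFlatness 𝒟 ↔ ∃ (θ τₑ : ℝ) (V : TopologicalSpace.Opens E4) (Φₑ : V → 𝒟.carrier), 0 < θ ∧
      {x : E4 | τₑ < x 0 ∧ (1 - θ) * x 0 < E4.spatialNorm x} ⊆ (V : Set E4) ∧
      𝒟.toSpacetime.IsLateChart (Minkowski.backgroundOn V)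
        (𝒟.metric.causalFuture 𝒟.timeOrientation (Set.range 𝒟.embed)) τₑ Φₑ ∧
      Tendsto (fun τ ↦ 𝒟.toSpacetime.deviationCk (Minkowski.backgroundOn V) Φₑ 2 τ) atTop (𝓝 0) ∧
      ∀ᶠ τ in atTop, ∀ x ∈ (Minkowski.backgroundOn V).timeSlab τ,
        𝒟.timeOrientation.IsFutureDirected (mfderiv 𝓘(ℝ, E4) (𝓡 4) Φₑ x (E4.basisVector 0)) :=
  Iff.rfl

/-! ## The two registered stubs (v4) -/

/-- **Registered stub A — Repair A of the crux (the crux proper; XXL; conditional on `ThriftyKerrStability`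
exactly as the crux is).**  Granted thrifty Kerr stability: for every admissible datum, every MGHD with complete
`𝓘⁺`, a thrifty `N`-hole hand-over (`FullHandoff`, verbatim the crux's antecedent) AND an outer-zone flatness
certificate (aperture `θ > 0`, a late flat chart `Φₑ` on an open `V ⊇ {x⁰ > τₑ, |x̲| > (1 − θ) x⁰}` into `J⁺(ι X)` with
full-slab sup-`C²` deviation from `η` tending to `0` and `∂₀` eventually future-directed), the exterior settles in the
re-typed sense: `∃ O d`, sub-extremal holes, `O = exteriorOf 𝒟 d.charted`, `HasExhaustiveCharts d`,
`IsFutureOriented d`.  Token-identical to the first conjunct of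
`Theorems.DerivativeThrift.ThriftyClusterSettling.thriftyClusterSettling_iff_repairA_and_forcedOuterFlatness`
(p153616) and definitionally equal to `ThriftyClusterSettlingRepairA` below (`repairA_iff_stubSig`).  NECESSARY:
`stub_repairA_necessary`.  Intended proof (route dossier "RecedingDecoupling → ExhaustiveBookkeeping"; v3 header):
rest-frame reduction of the lab-frame `N`-hole layers; `ThriftyKerrStability` per hole; the Minkowski leg
(`ThriftyMinkowskiStability`, item 17613) and receding decoupling (ILED/`r^p` uniform on the moving `N`-centre
background — nothing printed) for ONE flat chart on the inner cone minus sublinear tubes, seamed in the datum's rest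
frame with the outer chart across the band `(1 − θ) x⁰ < |x̲| < x⁰ − u₀`; horizon penetration, far hole charts, the
StarvedNecks certificate `SeamedAtlas` and the landed packaging (`repairA_of_seamedAtlasRoute`).  Why it might fail /
why it cannot move as typed (`Lines/registered-stuck-c8.md` §2(b),(c)): `ThriftyKerrStability` consumes TOTAL
single-hole rest-frame shells and is not invocable from the `N`-hole hand-over for `N ≥ 2` (foreign-hole flux
`≳ d^{1/4} M₂^{1/2} → ∞`), nor for `N = 1` without a containment the antecedent does not promise, and is idle for
`N = 0` (layer-form Minkowski stability at `p = 1/2`, item 17613, is then INSIDE this stub); two rate-free certificates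
(inner atlas, outer chart) cannot be seamed without a gauge tie.  Sources: KlainermanSzeftel2023 §3; arXiv:2205.14808;
Hintz2026; DafermosRodnianski2010ICMP; Moschidis2016; Bieri2010JDG; arXiv:1710.01722 (Conj. 1). -/
theorem stub_repairA : Theses.DerivativeThrift.ThriftyKerrStability → ∀ (X : Type) [TopologicalSpace X] [ChartedSpace E3 X] [IsManifold (𝓡 3) ∞ X] [T2Space X] [SecondCountableTopology X] [ConnectedSpace X] (D : InitialDataSet (𝓡 3) X), D ∈ admissibleVacuumData X → ∀ 𝒟 : VacuumCauchyDevelopment D, 𝒟.IsMaximal → HasCompleteNullInfinity 𝒟.toCauchyDevelopment → Theorems.DerivativeThriftThriftyHandoff.FullHandoff 𝒟 → (∃ (θ τₑ : ℝ) (V : Opens E4) (Φₑ : V → 𝒟.carrier), 0 < θ ∧ {x : E4 | τₑ < x 0 ∧ (1 - θ) * x 0 < E4.spatialNorm x} ⊆ (V : Set E4) ∧ 𝒟.toSpacetime.IsLateChart (Minkowski.backgroundOn V) (𝒟.metric.causalFuture 𝒟.timeOrientation (Set.range 𝒟.embed)) τₑ Φₑ ∧ Tendsto (fun τ ↦ 𝒟.toSpacetime.deviationCk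 (Minkowski.backgroundOn V) Φₑ 2 τ) atTop (𝓝 0) ∧ ∀ᶠ τ in atTop, ∀ x ∈ (Minkowski.backgroundOn V).timeSlab τ, 𝒟.timeOrientation.IsFutureDirected (mfderiv 𝓘(ℝ, E4) (𝓡 4) Φₑ x (E4.basisVector 0))) → ∃ (O : Set 𝒟.carrier) (d : FinalStateDecomposition 𝒟.toSpacetime O 2), (∀ i, Kerr.IsSubextremal (d.mass i) (d.spin i)) ∧ O = exteriorOf 𝒟.toCauchyDevelopment d.charted ∧ HasExhaustiveCharts d ∧ IsFutureOriented d := by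
  sorry

/-- **Registered stub F — forced outer-zone flatness (the conjunct of the crux no hypothesis feeds; v3's
`stub_outerZoneFlatness` with its two in-scope hypotheses restored).**  Granted `ThriftyKerrStability`: every MGHD of
admissible data with complete `𝓘⁺` and a thrifty `N`-hole hand-over (`FullHandoff`) carries an outer-zone flatness
certificate (as in stub A's antecedent).  Token-identical to the second conjunct of p153616; NECESSARY
(`stub_forcedOuterFlatness_necessary` = p153616's projection 2 = p150580 `thriftyClusterSettling_forces_outerFlatness`):
the consequent's flat chart lives on `{x⁰ > τ₀}` minus sublinear tubes, which contains a cone complement.  Why it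
cannot be proved as typed: no hypothesis in scope carries metric information on the cone complement
(`ThriftyKerrStability` certifies near zones inside `J⁺` of single-hole layers; late layers of scale `ℓ` control only
`J⁺(layer)`; complete `𝓘⁺` is the sojourn form and exports no chart; maximality/admissibility carry no late-time metric
information), no tree producer of a late flat chart of an abstract MGHD exists (delta audits c5–c9), and no printed
exterior-stability theorem covers the admissible `o₂(r⁻¹)/o₁(r⁻²)` class (item evidence DICTIONARY.md §8).  Paper
status: under `ThriftyKerrStability` (k = 2) FALSE pointwise (far-field focusing packets, CRUX-ATTACK.md, c1 VERDICT.md,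
c5 §2); if `ThriftyKerrStability` as filed is false (same packets) the stub holds vacuously and is then `¬TKS₂` in
disguise (hinge p159766) — unreachable in kernel either way (needs a constructed non-flat admissible MGHD).  Both
bodies hold on the trivial fibre (p155684), so no cheap kernel refutation exists.  Recorded repair: restate the CRUX
(Repair A/B, k := 3) so that this conjunct disappears.  Sources: KlainermanNicolo2003; Bieri2010JDG;
ChristodoulouKlainerman1993; arXiv:1204.1767; DafermosRodnianski2010ICMP. -/
theorem stub_forcedOuterFlatness : Theses.DerivativeThrift.ThriftyKerrStability → ∀ (X : Type) [TopologicalSpace X] [ChartedSpace E3 X] [IsManifold (𝓡 3) ∞ X] [T2Space X] [SecondCountableTopology X] [ConnectedSpace X] (D : InitialDataSet (𝓡 3) X), D ∈ admissibleVacuumData X → ∀ 𝒟 : VacuumCauchyDevelopment D, 𝒟.IsMaximal → HasCompleteNullInfinity 𝒟.toCauchyDevelopment → Theorems.DerivativeThriftThriftyHandoff.FullHandoff 𝒟 → ∃ (θ τₑ : ℝ) (V : Opens E4) (Φₑ : V → 𝒟.carrier), 0 < θ ∧ {x : E4 | τₑ < x 0 ∧ (1 - θ) * x 0 < E4.spatialNorm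 x} ⊆ (V : Set E4) ∧ 𝒟.toSpacetime.IsLateChart (Minkowski.backgroundOn V) (𝒟.metric.causalFuture 𝒟.timeOrientation (Set.range 𝒟.embed)) τₑ Φₑ ∧ Tendsto (fun τ ↦ 𝒟.toSpacetime.deviationCk (Minkowski.backgroundOn V) Φₑ 2 τ) atTop (𝓝 0) ∧ ∀ᶠ τ in atTop, ∀ x ∈ (Minkowski.backgroundOn V).timeSlab τ, 𝒟.timeOrientation.IsFutureDirected (mfderiv 𝓘(ℝ, E4) (𝓡 4) Φₑ x (E4.basisVector 0)) := by
  sorry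

/-! ## The composition: the crux BY NAME from the two stub statements, and its tightness -/

/-- The crux under a local reducible alias — used ONLY as the result type of the sorry-free composition
`cruxAlias_of_sigs`, so that the skeleton audit sees exactly one theorem concluding the crux by name
(`ThriftyClusterSettling_of`). -/
abbrev CruxAlias : Prop := Theses.DerivativeThrift.ThriftyClusterSettling

/-- **The crux as filed is EQUIVALENT to the conjunction of the two registered stub signatures** (kernel; this is
p153616 `thriftyClusterSettling_iff_repairA_and_forcedOuterFlatness` re-exported for the skeleton audit). -/
theorem crux_iff_stubSigs : CruxAlias ↔ ((Theses.DerivativeThrift.ThriftyKerrStability → ∀ (X : Type) [TopologicalSpace X] [ChartedSpace E3 X] [IsManifold (𝓡 3) ∞ X] [T2Space X] [SecondCountableTopology X] [ConnectedSpace X] (D : InitialDataSet (𝓡 3) X), D ∈ admissibleVacuumData X → ∀ 𝒟 : VacuumCauchyDevelopment D, 𝒟.IsMaximal → HasCompleteNullInfinity 𝒟.toCauchyDevelopment → Theorems.DerivativeThriftThriftyHandoff.FullHandoff 𝒟 → (∃ (θ τₑ : ℝ) (V : Opens E4) (Φₑ : V → 𝒟.carrier), 0 < θ ∧ {x : E4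 | τₑ < x 0 ∧ (1 - θ) * x 0 < E4.spatialNorm x} ⊆ (V : Set E4) ∧ 𝒟.toSpacetime.IsLateChart (Minkowski.backgroundOn V) (𝒟.metric.causalFuture 𝒟.timeOrientation (Set.range 𝒟.embed)) τₑ Φₑ ∧ Tendsto (fun τ ↦ 𝒟.toSpacetime.deviationCk (Minkowski.backgroundOn V) Φₑ 2 τ) atTop (𝓝 0) ∧ ∀ᶠ τ in atTop, ∀ x ∈ (Minkowski.backgroundOn V).timeSlab τ, 𝒟.timeOrientation.IsFutureDirected (mfderiv 𝓘(ℝ, E4) (𝓡 4) Φₑ x (E4.basisVector 0))) → ∃ (O : Set 𝒟.carrier) (d : FinalStateDecomposition 𝒟.toSpacetime O 2), (∀ i, Kerr.IsSubextremal (d.mass i) (d.spin i)) ∧ O = exteriorOf 𝒟.toCauchyDevelopment d.charted ∧ HasExhaustiveCharts d ∧ IsFutureOriented d) ∧ (Theses.DerivativeThrift.ThriftyKerrStability → ∀ (X : Type) [TopologicalSpace X] [ChartedSpace E3 X] [IsManifold (𝓡 3) ∞ X] [T2Space X] [SecondCountableTopology X] [ConnectedSpace X] (D : InitialDataSet (𝓡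 3) X), D ∈ admissibleVacuumData X → ∀ 𝒟 : VacuumCauchyDevelopment D, 𝒟.IsMaximal → HasCompleteNullInfinity 𝒟.toCauchyDevelopment → Theorems.DerivativeThriftThriftyHandoff.FullHandoff 𝒟 → ∃ (θ τₑ : ℝ) (V : Opens E4) (Φₑ : V → 𝒟.carrier), 0 < θ ∧ {x : E4 | τₑ < x 0 ∧ (1 - θ) * x 0 < E4.spatialNorm x} ⊆ (V : Set E4) ∧ 𝒟.toSpacetime.IsLateChart (Minkowski.backgroundOn V) (𝒟.metric.causalFuture 𝒟.timeOrientation (Set.range 𝒟.embed)) τₑ Φₑ ∧ Tendsto (fun τ ↦ 𝒟.toSpacetime.deviationCk (Minkowski.backgroundOn V) Φₑ 2 τ) atTop (𝓝 0) ∧ ∀ᶠ τ in atTop, ∀ x ∈ (Minkowski.backgroundOn V).timeSlab τ, 𝒟.timeOrientation.IsFutureDirected (mfderiv 𝓘(ℝ, E4) (𝓡 4) Φₑ x (E4.basisVector 0)))) :=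
  Theorems.DerivativeThrift.ThriftyClusterSettling.thriftyClusterSettling_iff_repairA_and_forcedOuterFlatness

/-- **The two stub SIGNATURES imply the crux** (NO `sorry`; axioms ⊆ {propext, Classical.choice, Quot.sound}). -/
theorem cruxAlias_of_sigs (hA : Theses.DerivativeThrift.ThriftyKerrStability → ∀ (X : Type) [TopologicalSpace X] [ChartedSpace E3 X] [IsManifold (𝓡 3) ∞ X] [T2Space X] [SecondCountableTopology X] [ConnectedSpace X] (D : InitialDataSet (𝓡 3) X), D ∈ admissibleVacuumData X → ∀ 𝒟 : VacuumCauchyDevelopment D, 𝒟.IsMaximal → HasCompleteNullInfinity 𝒟.toCauchyDevelopment → Theorems.DerivativeThriftThriftyHandoff.FullHandoff 𝒟 → (∃ (θ τₑ : ℝ) (V : Opens E4) (Φₑ : V → 𝒟.carrier), 0 < θ ∧ {x : E4 | τₑ < x 0 ∧ (1 - θ) * x 0 < E4.spatialNorm x} ⊆ (V : Set E4) ∧ 𝒟.toSpacetime.IsLateChart (Minkowski.backgroundOn V) (𝒟.metric.causalFuture 𝒟.timeOrientation (Set.range 𝒟.embed)) τₑ Φₑ ∧ Tendsto (fun τ ↦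 𝒟.toSpacetime.deviationCk (Minkowski.backgroundOn V) Φₑ 2 τ) atTop (𝓝 0) ∧ ∀ᶠ τ in atTop, ∀ x ∈ (Minkowski.backgroundOn V).timeSlab τ, 𝒟.timeOrientation.IsFutureDirected (mfderiv 𝓘(ℝ, E4) (𝓡 4) Φₑ x (E4.basisVector 0))) → ∃ (O : Set 𝒟.carrier) (d : FinalStateDecomposition 𝒟.toSpacetime O 2), (∀ i, Kerr.IsSubextremal (d.mass i) (d.spin i)) ∧ O = exteriorOf 𝒟.toCauchyDevelopment d.charted ∧ HasExhaustiveCharts d ∧ IsFutureOriented d) (hF : Theses.DerivativeThrift.ThriftyKerrStability → ∀ (X : Type) [TopologicalSpace X] [ChartedSpace E3 X] [IsManifold (𝓡 3) ∞ X] [T2Space X] [SecondCountableTopology X] [ConnectedSpace X] (D : InitialDataSet (𝓡 3) X), D ∈ admissibleVacuumData X → ∀ 𝒟 : VacuumCauchyDevelopment D, 𝒟.IsMaximal → HasCompleteNullInfinity 𝒟.toCauchyDevelopment → Theorems.DerivativeThriftThriftyHandoff.FullHandoff 𝒟 → ∃ (θ τₑ : ℝ) (V : Opens E4) (Φₑ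 : V → 𝒟.carrier), 0 < θ ∧ {x : E4 | τₑ < x 0 ∧ (1 - θ) * x 0 < E4.spatialNorm x} ⊆ (V : Set E4) ∧ 𝒟.toSpacetime.IsLateChart (Minkowski.backgroundOn V) (𝒟.metric.causalFuture 𝒟.timeOrientation (Set.range 𝒟.embed)) τₑ Φₑ ∧ Tendsto (fun τ ↦ 𝒟.toSpacetime.deviationCk (Minkowski.backgroundOn V) Φₑ 2 τ) atTop (𝓝 0) ∧ ∀ᶠ τ in atTop, ∀ x ∈ (Minkowski.backgroundOn V).timeSlab τ, 𝒟.timeOrientation.IsFutureDirected (mfderiv 𝓘(ℝ, E4) (𝓡 4) Φₑ x (E4.basisVector 0))) : CruxAlias :=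
  crux_iff_stubSigs.2 ⟨hA, hF⟩

/-- **Registered skeleton theorem — `ThriftyClusterSettling` BY NAME from the two declared stubs** (`sorry` only
inside `stub_repairA`, `stub_forcedOuterFlatness`; this declaration itself contains none). -/
theorem ThriftyClusterSettling_of : Theses.DerivativeThrift.ThriftyClusterSettling :=
  cruxAlias_of_sigs stub_repairA stub_forcedOuterFlatness

/-- **Stub A is necessary**: the crux as filed implies the signature of `stub_repairA` (p153616, projection 1). -/
theorem stub_repairA_necessary (h : Theses.DerivativeThrift.ThriftyClusterSettling) : Theses.DerivativeThrift.ThriftyKerrStability → ∀ (X : Type) [TopologicalSpace X] [ChartedSpace E3 X] [IsManifold (𝓡 3) ∞ X] [T2Space X] [SecondCountableTopology X] [ConnectedSpace X] (D : InitialDataSet (𝓡 3) X), D ∈ admissibleVacuumData X → ∀ 𝒟 : VacuumCauchyDevelopment D, 𝒟.IsMaximal → HasCompleteNullInfinity 𝒟.toCauchyDevelopment → Theorems.DerivativeThriftThriftyHandoff.FullHandoff 𝒟 → (∃ (θ τₑ : ℝ) (V : Opens E4) (Φₑ : V → 𝒟.carrier), 0 < θ ∧ {x : E4 | τₑ < x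 0 ∧ (1 - θ) * x 0 < E4.spatialNorm x} ⊆ (V : Set E4) ∧ 𝒟.toSpacetime.IsLateChart (Minkowski.backgroundOn V) (𝒟.metric.causalFuture 𝒟.timeOrientation (Set.range 𝒟.embed)) τₑ Φₑ ∧ Tendsto (fun τ ↦ 𝒟.toSpacetime.deviationCk (Minkowski.backgroundOn V) Φₑ 2 τ) atTop (𝓝 0) ∧ ∀ᶠ τ in atTop, ∀ x ∈ (Minkowski.backgroundOn V).timeSlab τ, 𝒟.timeOrientation.IsFutureDirected (mfderiv 𝓘(ℝ, E4) (𝓡 4) Φₑ x (E4.basisVector 0))) → ∃ (O : Set 𝒟.carrier) (d : FinalStateDecomposition 𝒟.toSpacetime O 2), (∀ i, Kerr.IsSubextremal (d.mass i) (d.spin i)) ∧ O = exteriorOf 𝒟.toCauchyDevelopment d.charted ∧ HasExhaustiveCharts d ∧ IsFutureOriented d :=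
  Theorems.DerivativeThrift.ThriftyClusterSettling.repairA_of_thriftyClusterSettling h

/-- **Stub F is necessary**: the crux as filed implies the signature of `stub_forcedOuterFlatness` (p153616,
projection 2 = p150580). -/
theorem stub_forcedOuterFlatness_necessary (h : Theses.DerivativeThrift.ThriftyClusterSettling) : Theses.DerivativeThrift.ThriftyKerrStability → ∀ (X : Type) [TopologicalSpace X] [ChartedSpace E3 X] [IsManifold (𝓡 3) ∞ X] [T2Space X] [SecondCountableTopology X] [ConnectedSpace X] (D : InitialDataSet (𝓡 3) X), D ∈ admissibleVacuumData X → ∀ 𝒟 : VacuumCauchyDevelopment D, 𝒟.IsMaximal → HasCompleteNullInfinity 𝒟.toCauchyDevelopment → Theorems.DerivativeThriftThriftyHandoff.FullHandoff 𝒟 → ∃ (θ τₑ : ℝ) (V : Opens E4) (Φₑ : V → 𝒟.carrier), 0 < θ ∧ {x : E4 | τₑ < x 0 ∧ (1 - θ) * x 0 < E4.spatialNorm x} ⊆ (V : Set E4) ∧ 𝒟.toSpacetime.IsLateChart (Minkowski.backgroundOn V) (𝒟.metric.causalFuture 𝒟.timeOrientation (Set.range 𝒟.embed)) τₑ Φₑ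 ∧ Tendsto (fun τ ↦ 𝒟.toSpacetime.deviationCk (Minkowski.backgroundOn V) Φₑ 2 τ) atTop (𝓝 0) ∧ ∀ᶠ τ in atTop, ∀ x ∈ (Minkowski.backgroundOn V).timeSlab τ, 𝒟.timeOrientation.IsFutureDirected (mfderiv 𝓘(ℝ, E4) (𝓡 4) Φₑ x (E4.basisVector 0)) :=
  Theorems.DerivativeThrift.ThriftyClusterSettling.forcedOuterFlatness_of_thriftyClusterSettling h

/-! ## The intended route to stub A (v3 content, kept): seamed atlas ⊕ landed packaging -/

/-- **Registered stub 3' — a seamed atlas settles the exterior (S; packaging over LANDED StarvedNecks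
theorems; stated self-contained, `Hc`/`Sm` let-bound token-identically to
`Theses.StarvedNecks.SeamedChartsExhaust`).**  For every admissible datum and MGHD `𝒟`, every region
`O`, `C²` decomposition `d` of `O`, radii `R`, `R₀` with `O = exteriorOf 𝒟 d.charted`, HonestCore(`d`,
`R₀`) and SEAMED(`d`, `R`, `R₀`): the crux's consequent verbatim — witnessed by the same `(O, d)`;
sub-extremality is HonestCore (a); `HasExhaustiveCharts d` is the proved crux
`StarvedNecks.SeamedChartsExhaust` (`Theorems.SeamedChartsExhaust.WideAnchoring.seamedChartsExhaust`,
stmt-13551) and `IsFutureOriented d` the proved crux `StarvedNecks.FutureOrientedOfSeamed`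
(`Theorems.FutureOrientedOfSeamed.ClockDualityRays.FutureOrientedOfSeamed_of`, stmt-17576).  LANDED:
p145999 (`Theorems/DerivativeThriftThriftyClusterSettlingStubSeamedAtlasSettles.lean`, commit ddf5cc42c1ed, axioms
propext/Classical.choice/Quot.sound); proved inline below with the same proof (no `sorry`).
O'Neill 1983, Ch. 14, pp. 402–403; DHRT arXiv:2104.08222, §1. -/
theorem stub_seamedAtlasSettles : let Hc := ( fun (𝓢 : Spacetime.{0} 4) (O : Set 𝓢.carrier) (k : ℕ) (d : FinalStateDecomposition 𝓢 O k) (R₀ : ℝ) => let B := d.background; let t := fun i ↦ (B i).time; let r := fun i ↦ (B i).radius; let Ψ := d.chart; (∀ i, Kerr.IsSubextremal (d.mass i) (d.spin i) ∧ 100 * d.mass i ≤ R₀ ∧ 0 < ((d.motion i).1 : E4 ≃L[ℝ] E4) (E4.basisVector 0) 0) ∧ (∀ i (ϱ τ₂ : ℝ), R₀ ≤ ϱ → d.τ₀ < τ₂ → Ψ i '' {x | d.τ₀ < t i x.1 ∧ t i x.1 < τ₂ ∧ r i x.1 < ϱ} ⊆ 𝓢.metric.causalPast 𝓢.timeOrientation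 (Ψ i '' (B i).truncTimeSlab ϱ τ₂)) ∧ (∀ i (τ' : ℝ) (ϱ : ℝ → ℝ), Continuous ϱ → d.τ₀ < τ' → let A := Ψ i '' {x | τ' ≤ t i x.1 ∧ r i x.1 ≤ ϱ (t i x.1)}; closure A ∩ O ⊆ A) ∧ (∀ y : d.flatDomain, d.τ₀ < y.1 0 → 𝓢.timeOrientation.IsFutureDirected (mfderiv 𝓘(ℝ, E4) (𝓡 4) d.flatChart y (E4.basisVector 0))) ); let Sm := ( fun (𝓢 : Spacetime.{0} 4) (O : Set 𝓢.carrier) (d : FinalStateDecomposition 𝓢 O 2) (R : Fin d.N → ℝ → ℝ) (R₀ : ℝ) => let B := d.background; let t := fun i ↦ (B i).time; let r := fun i ↦ (B i).radius; let Λ := fun i ↦ ((d.motion i).1 : E4 ≃L[ℝ] E4); let Φ := d.flatChart; let Ψ := d.chart; let ρ := d.excision; (∀ i, Monotone (R i) ∧ Continuous (R i) ∧ ∀ s, R₀ + 4 ≤ R i s ∧ R₀ ≤ ρ i s) ∧ (∀ i, Tendsto (fun τ ↦ 𝓢.truncDeviationCk (B i) (Ψ i) 2 (R i τ) τ) atTop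 (𝓝 0)) ∧ supCkENorm (Subtype.val '' {y : d.flatDomain | d.τ₀ ≤ y.1 0}) 0 (𝓢.deviationExtend (Minkowski.backgroundOn d.flatDomain) Φ) ≤ 10⁻¹ ∧ (∀ i, supCkENorm (Subtype.val '' {x : (B i).domain | (d.τ₀ ≤ t i x.1 ∨ d.τ₀ ≤ x.1 0) ∧ R₀ ≤ r i x.1 ∧ r i x.1 ≤ R i (t i x.1)}) 0 (𝓢.deviationExtend (B i) (Ψ i)) ≤ ENNReal.ofReal (1 / (10 * ‖(Λ i : E4 →L[ℝ] E4)‖ ^ 2))) ∧ (∀ i (x : (B i).domain), (d.τ₀ ≤ t i x.1 ∨ d.τ₀ ≤ x.1 0) → R₀ ≤ r i x.1 → r i x.1 ≤ R i (t i x.1) → 𝓢.timeOrientation.IsFutureDirected (mfderiv 𝓘(ℝ, E4) (𝓡 4) (Ψ i) x ((Λ i) (E4.basisVector 0)))) ∧ (∀ i (y : E4) (hy : y ∈ (B i).domain), d.τ₀ ≤ y 0 → (∀ j, ρ j (y 0) < r j y) → r i y ≤ R i (t i y) + 1 → ∃ hy' : y ∈ d.flatDomain, Ψ i ⟨y, hy⟩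 = Φ ⟨y, hy'⟩) ∧ (∀ y : d.flatDomain, d.τ₀ ≤ y.1 0 → ∀ j, ρ j (y.1 0) < r j y.1) ∧ (∀ j (y : E4), d.τ₀ ≤ y 0 → r j y ≤ ρ j (y 0) → r j y + 2 ≤ R j (t j y)) ∧ (∀ j (y : E4), d.τ₀ ≤ t j y → r j y ≤ R j (t j y) + 2 → t j y ≤ y 0) ∧ (∀ j, Ψ j '' {x | d.τ₀ < t j x.1 ∧ R j (t j x.1) + 1 < r j x.1} ⊆ d.radiationZone) ∧ (∀ τ' : ℝ, d.τ₀ < τ' → closure (Φ '' {y | τ' ≤ y.1 0}) ⊆ Φ '' {y | τ' ≤ y.1 0} ∪ ⋃ j, Ψ j '' {x | τ' ≤ x.1 0 ∧ r j x.1 = ρ j (x.1 0)}) ∧ (∀ j j' (y : E4), j ≠ j' → (d.τ₀ ≤ y 0 ∨ d.τ₀ ≤ t j y) → r j y ≤ R j (t j y) + 1 → R j' (t j' y) + 1 < r j' y) ); ∀ (X : Type) [TopologicalSpace X] [ChartedSpace E3 X] [IsManifold (𝓡 3) ∞ X] [T2Space X] [SecondCountableTopology X] [ConnectedSpace X] (D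 : InitialDataSet (𝓡 3) X), D ∈ admissibleVacuumData X → ∀ 𝒟 : VacuumCauchyDevelopment D, 𝒟.IsMaximal → ∀ (O : Set 𝒟.carrier) (d : FinalStateDecomposition 𝒟.toSpacetime O 2) (R : Fin d.N → ℝ → ℝ) (R₀ : ℝ), O = exteriorOf 𝒟.toCauchyDevelopment d.charted → Hc 𝒟.toSpacetime O 2 d R₀ → Sm 𝒟.toSpacetime O d R R₀ → ∃ (O' : Set 𝒟.carrier) (d' : FinalStateDecomposition 𝒟.toSpacetime O' 2), (∀ i, Kerr.IsSubextremal (d'.mass i) (d'.spin i)) ∧ O' = exteriorOf 𝒟.toCauchyDevelopment d'.charted ∧ HasExhaustiveCharts d' ∧ IsFutureOriented d' := by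
  -- LANDED as `…Theorems.DerivativeThrift.ThriftyClusterSettling.stub_seamedAtlasSettles` (p145999, commit
  -- ddf5cc42c1ed); the same 8-line proof is kept inline so that this workfile does not depend on the new module.
  intro Hc Sm X _ _ _ _ _ _ D hD 𝒟 h𝒟 O d R R₀ hO hc hs
  have hex :=
    _root_.Summit.FinalStateConjecture.FinalStateConjecture.Theorems.SeamedChartsExhaust.WideAnchoring.seamedChartsExhaust
  have hfo :=
    _root_.Summit.FinalStateConjecture.FinalStateConjecture.Theorems.FutureOrientedOfSeamed.ClockDualityRays.FutureOrientedOfSeamed_of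
  dsimp only [Theses.StarvedNecks.SeamedChartsExhaust] at hex
  dsimp only [Theses.StarvedNecks.FutureOrientedOfSeamed] at hfo
  exact ⟨O, d, fun i ↦ (hc.1 i).1, hO, hex X D hD 𝒟 h𝒟 O d R R₀ hO hc hs,
    hfo X D hD 𝒟 h𝒟 O d R R₀ hO hc hs⟩

/-- **The v3 route closes stub A**: a proof of v3's analytic stub 1' (TKS → admissible → MGHD → complete 𝓘⁺ →
`ThriftyHandover 𝒟 → OuterFlatness 𝒟 → SeamedAtlas 𝒟`) together with the LANDED packaging stub 3' (p145999) yields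
the signature of `stub_repairA` (kernel; the hand-over and the certificate are passed through the definitional
identities `thriftyHandover_iff_fullHandoff` / `outerFlatness_iff`). -/
theorem repairA_of_seamedAtlasRoute
    (h₁ : Theses.DerivativeThrift.ThriftyKerrStability →
      ∀ (X : Type) [TopologicalSpace X] [ChartedSpace E3 X] [IsManifold (𝓡 3) ∞ X] [T2Space X]
        [SecondCountableTopology X] [ConnectedSpace X] (D : InitialDataSet (𝓡 3) X),
        D ∈ admissibleVacuumData X → ∀ 𝒟 : VacuumCauchyDevelopment D, 𝒟.IsMaximal →
        HasCompleteNullInfinity 𝒟.toCauchyDevelopment → ThriftyHandover 𝒟 → OuterFlatness 𝒟 →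
        SeamedAtlas 𝒟)
    (h₃ : let Hc := ( fun (𝓢 : Spacetime.{0} 4) (O : Set 𝓢.carrier) (k : ℕ) (d : FinalStateDecomposition 𝓢 O k) (R₀ : ℝ) => let B := d.background; let t := fun i ↦ (B i).time; let r := fun i ↦ (B i).radius; let Ψ := d.chart; (∀ i, Kerr.IsSubextremal (d.mass i) (d.spin i) ∧ 100 * d.mass i ≤ R₀ ∧ 0 < ((d.motion i).1 : E4 ≃L[ℝ] E4) (E4.basisVector 0) 0) ∧ (∀ i (ϱ τ₂ : ℝ), R₀ ≤ ϱ → d.τ₀ < τ₂ → Ψ i '' {x | d.τ₀ < t i x.1 ∧ t i x.1 < τ₂ ∧ r i x.1 < ϱ} ⊆ 𝓢.metric.causalPast 𝓢.timeOrientation (Ψ i '' (B i).truncTimeSlab ϱ τ₂)) ∧ (∀ i (τ' : ℝ) (ϱ : ℝ → ℝ), Continuous ϱ → d.τ₀ < τ' → let A := Ψ i '' {x | τ' ≤ t i x.1 ∧ r i x.1 ≤ ϱ (t i x.1)}; closure A ∩ O ⊆ A) ∧ (∀ y : d.flatDomain, d.τ₀ < y.1 0 → 𝓢.timeOrientation.IsFutureDirected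 (mfderiv 𝓘(ℝ, E4) (𝓡 4) d.flatChart y (E4.basisVector 0))) ); let Sm := ( fun (𝓢 : Spacetime.{0} 4) (O : Set 𝓢.carrier) (d : FinalStateDecomposition 𝓢 O 2) (R : Fin d.N → ℝ → ℝ) (R₀ : ℝ) => let B := d.background; let t := fun i ↦ (B i).time; let r := fun i ↦ (B i).radius; let Λ := fun i ↦ ((d.motion i).1 : E4 ≃L[ℝ] E4); let Φ := d.flatChart; let Ψ := d.chart; let ρ := d.excision; (∀ i, Monotone (R i) ∧ Continuous (R i) ∧ ∀ s, R₀ + 4 ≤ R i s ∧ R₀ ≤ ρ i s) ∧ (∀ i, Tendsto (fun τ ↦ 𝓢.truncDeviationCk (B i) (Ψ i) 2 (R i τ) τ) atTop (𝓝 0)) ∧ supCkENorm (Subtype.val '' {y : d.flatDomain | d.τ₀ ≤ y.1 0}) 0 (𝓢.deviationExtend (Minkowski.backgroundOn d.flatDomain) Φ) ≤ 10⁻¹ ∧ (∀ i, supCkENorm (Subtype.val '' {x : (B i).domain | (d.τ₀ ≤ t i x.1 ∨ d.τ₀ ≤ x.1 0) ∧ R₀ ≤ r i x.1 ∧ r i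 x.1 ≤ R i (t i x.1)}) 0 (𝓢.deviationExtend (B i) (Ψ i)) ≤ ENNReal.ofReal (1 / (10 * ‖(Λ i : E4 →L[ℝ] E4)‖ ^ 2))) ∧ (∀ i (x : (B i).domain), (d.τ₀ ≤ t i x.1 ∨ d.τ₀ ≤ x.1 0) → R₀ ≤ r i x.1 → r i x.1 ≤ R i (t i x.1) → 𝓢.timeOrientation.IsFutureDirected (mfderiv 𝓘(ℝ, E4) (𝓡 4) (Ψ i) x ((Λ i) (E4.basisVector 0)))) ∧ (∀ i (y : E4) (hy : y ∈ (B i).domain), d.τ₀ ≤ y 0 → (∀ j, ρ j (y 0) < r j y) → r i y ≤ R i (t i y) + 1 → ∃ hy' : y ∈ d.flatDomain, Ψ i ⟨y, hy⟩ = Φ ⟨y, hy'⟩) ∧ (∀ y : d.flatDomain, d.τ₀ ≤ y.1 0 → ∀ j, ρ j (y.1 0) < r j y.1) ∧ (∀ j (y : E4), d.τ₀ ≤ y 0 → r j y ≤ ρ j (y 0) → r j y + 2 ≤ R j (t j y)) ∧ (∀ j (y : E4), d.τ₀ ≤ t j y → r j y ≤ R j (t j y) + 2 → t j y ≤ y 0)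 ∧ (∀ j, Ψ j '' {x | d.τ₀ < t j x.1 ∧ R j (t j x.1) + 1 < r j x.1} ⊆ d.radiationZone) ∧ (∀ τ' : ℝ, d.τ₀ < τ' → closure (Φ '' {y | τ' ≤ y.1 0}) ⊆ Φ '' {y | τ' ≤ y.1 0} ∪ ⋃ j, Ψ j '' {x | τ' ≤ x.1 0 ∧ r j x.1 = ρ j (x.1 0)}) ∧ (∀ j j' (y : E4), j ≠ j' → (d.τ₀ ≤ y 0 ∨ d.τ₀ ≤ t j y) → r j y ≤ R j (t j y) + 1 → R j' (t j' y) + 1 < r j' y) ); ∀ (X : Type) [TopologicalSpace X] [ChartedSpace E3 X] [IsManifold (𝓡 3) ∞ X] [T2Space X] [SecondCountableTopology X] [ConnectedSpace X] (D : InitialDataSet (𝓡 3) X), D ∈ admissibleVacuumData X → ∀ 𝒟 : VacuumCauchyDevelopment D, 𝒟.IsMaximal → ∀ (O : Set 𝒟.carrier) (d : FinalStateDecomposition 𝒟.toSpacetime O 2) (R : Fin d.N → ℝ → ℝ) (R₀ : ℝ), O = exteriorOf 𝒟.toCauchyDevelopment d.charted → Hc 𝒟.toSpacetime O 2 d R₀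 → Sm 𝒟.toSpacetime O d R R₀ → ∃ (O' : Set 𝒟.carrier) (d' : FinalStateDecomposition 𝒟.toSpacetime O' 2), (∀ i, Kerr.IsSubextremal (d'.mass i) (d'.spin i)) ∧ O' = exteriorOf 𝒟.toCauchyDevelopment d'.charted ∧ HasExhaustiveCharts d' ∧ IsFutureOriented d') :
    Theses.DerivativeThrift.ThriftyKerrStability → ∀ (X : Type) [TopologicalSpace X] [ChartedSpace E3 X] [IsManifold (𝓡 3) ∞ X] [T2Space X] [SecondCountableTopology X] [ConnectedSpace X] (D : InitialDataSet (𝓡 3) X), D ∈ admissibleVacuumData X → ∀ 𝒟 : VacuumCauchyDevelopment D, 𝒟.IsMaximal → HasCompleteNullInfinity 𝒟.toCauchyDevelopment → Theorems.DerivativeThriftThriftyHandoff.FullHandoff 𝒟 → (∃ (θ τₑ : ℝ) (V : Opens E4) (Φₑ : V → 𝒟.carrier), 0 < θ ∧ {x : E4 | τₑ < x 0 ∧ (1 - θ) * x 0 < E4.spatialNorm x} ⊆ (V : Set E4) ∧ 𝒟.toSpacetime.IsLateChart (Minkowski.backgroundOn V) (𝒟.metric.causalFuture 𝒟.timeOrientation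 (Set.range 𝒟.embed)) τₑ Φₑ ∧ Tendsto (fun τ ↦ 𝒟.toSpacetime.deviationCk (Minkowski.backgroundOn V) Φₑ 2 τ) atTop (𝓝 0) ∧ ∀ᶠ τ in atTop, ∀ x ∈ (Minkowski.backgroundOn V).timeSlab τ, 𝒟.timeOrientation.IsFutureDirected (mfderiv 𝓘(ℝ, E4) (𝓡 4) Φₑ x (E4.basisVector 0))) → ∃ (O : Set 𝒟.carrier) (d : FinalStateDecomposition 𝒟.toSpacetime O 2), (∀ i, Kerr.IsSubextremal (d.mass i) (d.spin i)) ∧ O = exteriorOf 𝒟.toCauchyDevelopment d.charted ∧ HasExhaustiveCharts d ∧ IsFutureOriented d := by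
  intro hK X _ _ _ _ _ _ D hD 𝒟 h𝒟 h𝓘 hF hcert
  have hH : ThriftyHandover 𝒟 := (thriftyHandover_iff_fullHandoff 𝒟).2 hF
  have hout : OuterFlatness 𝒟 := (outerFlatness_iff 𝒟).2 hcert
  obtain ⟨O, d, R, R₀, hO, hc, hs⟩ := h₁ hK X D hD 𝒟 h𝒟 h𝓘 hH hout
  exact h₃ X D hD 𝒟 h𝒟 O d R R₀ hO hc hs

/-! ## Appendix — the repaired crux texts (planner material; NOT part of the registered composition) -/


/-- **Repair A of the crux** (registrar's recorded repair, elaborated): `ThriftyClusterSettling` with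
the outer-zone flatness certificate `OuterFlatness 𝒟` added to the antecedent.  Planner material for
`--restate`; not a route decl. -/
def ThriftyClusterSettlingRepairA : Prop :=
  Theses.DerivativeThrift.ThriftyKerrStability →
  ∀ (X : Type) [TopologicalSpace X] [ChartedSpace E3 X] [IsManifold (𝓡 3) ∞ X] [T2Space X]
    [SecondCountableTopology X] [ConnectedSpace X] (D : InitialDataSet (𝓡 3) X),
    D ∈ admissibleVacuumData X → ∀ 𝒟 : VacuumCauchyDevelopment D, 𝒟.IsMaximal →
    HasCompleteNullInfinity 𝒟.toCauchyDevelopment → ThriftyHandover 𝒟 → OuterFlatness 𝒟 →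
    ∃ (O : Set 𝒟.carrier) (d : FinalStateDecomposition 𝒟.toSpacetime O 2),
      (∀ i, Kerr.IsSubextremal (d.mass i) (d.spin i)) ∧
      O = exteriorOf 𝒟.toCauchyDevelopment d.charted ∧ HasExhaustiveCharts d ∧
      IsFutureOriented d

/-- `ThriftyClusterSettlingRepairA` (v3 vocabulary) IS the signature of `stub_repairA` (definitional). -/
theorem repairA_iff_stubSig : ThriftyClusterSettlingRepairA ↔ (Theses.DerivativeThrift.ThriftyKerrStability → ∀ (X : Type) [TopologicalSpace X] [ChartedSpace E3 X] [IsManifold (𝓡 3) ∞ X] [T2Space X] [SecondCountableTopology X] [ConnectedSpace X] (D : InitialDataSet (𝓡 3) X), D ∈ admissibleVacuumData X → ∀ 𝒟 : VacuumCauchyDevelopment D, 𝒟.IsMaximal → HasCompleteNullInfinity 𝒟.toCauchyDevelopment → Theorems.DerivativeThriftThriftyHandoff.FullHandoff 𝒟 → (∃ (θ τₑ : ℝ) (V : Opens E4) (Φₑ : V → 𝒟.carrier), 0 < θ ∧ {x : E4 | τₑ < x 0 ∧ (1 - θ) * x 0 < E4.spatialNorm x} ⊆ (V : Set E4) ∧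 𝒟.toSpacetime.IsLateChart (Minkowski.backgroundOn V) (𝒟.metric.causalFuture 𝒟.timeOrientation (Set.range 𝒟.embed)) τₑ Φₑ ∧ Tendsto (fun τ ↦ 𝒟.toSpacetime.deviationCk (Minkowski.backgroundOn V) Φₑ 2 τ) atTop (𝓝 0) ∧ ∀ᶠ τ in atTop, ∀ x ∈ (Minkowski.backgroundOn V).timeSlab τ, 𝒟.timeOrientation.IsFutureDirected (mfderiv 𝓘(ℝ, E4) (𝓡 4) Φₑ x (E4.basisVector 0))) → ∃ (O : Set 𝒟.carrier) (d : FinalStateDecomposition 𝒟.toSpacetime O 2), (∀ i, Kerr.IsSubextremal (d.mass i) (d.spin i)) ∧ O = exteriorOf 𝒟.toCauchyDevelopment d.charted ∧ HasExhaustiveCharts d ∧ IsFutureOriented d) :=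
  Iff.rfl

/-- Repair A from the registered stub by name (`sorry` only inside `stub_repairA`). -/
theorem repairA_of_stubs : ThriftyClusterSettlingRepairA :=
  repairA_iff_stubSig.2 stub_repairA

/-- **Repair B of the crux** (lead's recommendation, elaborated): the hand-over carries ONE outer late
flat chart `Φₑ` on a cone complement `{x⁰ > τₑ, |x̲| > (1 − θ) x⁰}` (bound once, before `∀ ℓ ε τ₁`),
with full-slab `C²` deviation `→ 0` and `∂₀` eventually future-directed, and every late layer
embedding `Φ` AGREES with `Φₑ` at the layer points lying in that cone complement (one atlas; exact
coordinate identity).  Planner material for `--restate`; not a route decl. -/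
def ThriftyClusterSettlingRepairB : Prop :=
  Theses.DerivativeThrift.ThriftyKerrStability →
  ∀ (X : Type) [TopologicalSpace X] [ChartedSpace E3 X] [IsManifold (𝓡 3) ∞ X] [T2Space X]
    [SecondCountableTopology X] [ConnectedSpace X] (D : InitialDataSet (𝓡 3) X),
    D ∈ admissibleVacuumData X → ∀ 𝒟 : VacuumCauchyDevelopment D, 𝒟.IsMaximal →
    HasCompleteNullInfinity 𝒟.toCauchyDevelopment →
    (∃ (N : ℕ) (M a : Fin N → ℝ) (Λ : Fin N → ↥lorentzGroup),
      (∀ i, Kerr.IsSubextremal (M i) (a i)) ∧ (∀ i, IsOrthochronous (Λ i)) ∧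
      (∀ i j, i ≠ j →
        (((Λ i : E4 ≃L[ℝ] E4) (E4.basisVector 0)) 0)⁻¹ •
            E4.spatial ((Λ i : E4 ≃L[ℝ] E4) (E4.basisVector 0)) ≠
          (((Λ j : E4 ≃L[ℝ] E4) (E4.basisVector 0)) 0)⁻¹ •
            E4.spatial ((Λ j : E4 ≃L[ℝ] E4) (E4.basisVector 0))) ∧
      ∃ (θ τₑ : ℝ) (V : TopologicalSpace.Opens E4) (Φₑ : V → 𝒟.carrier), 0 < θ ∧
        {x : E4 | τₑ < x 0 ∧ (1 - θ) * x 0 < E4.spatialNorm x} ⊆ (V : Set E4) ∧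
        𝒟.toSpacetime.IsLateChart (Minkowski.backgroundOn V)
          (𝒟.metric.causalFuture 𝒟.timeOrientation (Set.range 𝒟.embed)) τₑ Φₑ ∧
        Tendsto (fun τ ↦ 𝒟.toSpacetime.deviationCk (Minkowski.backgroundOn V) Φₑ 2 τ) atTop (𝓝 0) ∧
        (∀ᶠ τ in atTop, ∀ x ∈ (Minkowski.backgroundOn V).timeSlab τ,
          𝒟.timeOrientation.IsFutureDirected (mfderiv 𝓘(ℝ, E4) (𝓡 4) Φₑ x (E4.basisVector 0))) ∧
        ∀ ℓ : ℝ, 0 < ℓ → ∀ ε : ℝ, 0 < ε → ∀ τ₁ : ℝ, ∃ τ : ℝ, τ₁ ≤ τ ∧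
          ∃ (ξ : Fin N → E3) (Φ : RecedingKerr.layer M a Λ ξ τ ℓ → 𝒟.carrier),
            (∀ i j, i ≠ j → ε⁻¹ ≤ ‖ξ i - ξ j‖ ∧
              0 ≤ @inner ℝ E3 _ (ξ i - ξ j)
                ((((Λ i : E4 ≃L[ℝ] E4) (E4.basisVector 0)) 0)⁻¹ •
                    E4.spatial ((Λ i : E4 ≃L[ℝ] E4) (E4.basisVector 0)) -
                  (((Λ j : E4 ≃L[ℝ] E4) (E4.basisVector 0)) 0)⁻¹ •
                    E4.spatial ((Λ j : E4 ≃L[ℝ] E4) (E4.basisVector 0)))) ∧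
            ContMDiff 𝓘(ℝ, E4) (𝓡 4) ((⊤ : ℕ∞) : WithTop ℕ∞) Φ ∧ Topology.IsOpenEmbedding Φ ∧
            Set.range Φ ⊆ 𝒟.metric.causalFuture 𝒟.timeOrientation (Set.range 𝒟.embed) ∧
            (∀ s₀ ∈ Set.Ioo 0 ℓ, 𝒟.metric.IsAchronal 𝒟.timeOrientation
              (Φ '' {x | RecedingKerr.layerTime τ ℓ x.1 = s₀})) ∧
            𝒟.toSpacetime.recedingKerrInitialLayerNorm M a Λ ξ τ ℓ 2 (1 / 2) (1 / 2) Φ ≤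
              ENNReal.ofReal ε ∧
            -- ONE ATLAS: the layer chart is the outer chart on the cone complement
            (∀ x : RecedingKerr.layer M a Λ ξ τ ℓ, τₑ < x.1 0 →
              (1 - θ) * x.1 0 < E4.spatialNorm x.1 → ∃ hx : x.1 ∈ V, Φ x = Φₑ ⟨x.1, hx⟩)) →
    ∃ (O : Set 𝒟.carrier) (d : FinalStateDecomposition 𝒟.toSpacetime O 2),
      (∀ i, Kerr.IsSubextremal (d.mass i) (d.spin i)) ∧
      O = exteriorOf 𝒟.toCauchyDevelopment d.charted ∧ HasExhaustiveCharts d ∧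
      IsFutureOriented d

/-- Repair B follows from Repair A (its antecedent contains a hand-over and an outer-flatness
certificate; the one-atlas tie is simply forgotten) — so stub A closes Repair B as well. -/
theorem repairB_of_repairA (h : ThriftyClusterSettlingRepairA) : ThriftyClusterSettlingRepairB := by
  intro hK X _ _ _ _ _ _ D hD 𝒟 h𝒟 h𝓘 hB
  obtain ⟨N, M, a, Λ, hsub, horth, hvel, θ, τₑ, V, Φₑ, hθ, hV, hlate, hdev, hfut, hlayers⟩ := hB
  refine h hK X D hD 𝒟 h𝒟 h𝓘 ⟨N, M, a, Λ, hsub, horth, hvel, ?_⟩ ⟨θ, τₑ, V, Φₑ, hθ, hV, hlate, hdev, hfut⟩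
  intro ℓ hℓ ε hε τ₁
  obtain ⟨τ, hτ, ξ, Φ, hsep, hsm, hemb, hJ, hach, hnorm, -⟩ := hlayers ℓ hℓ ε hε τ₁
  exact ⟨τ, hτ, ξ, Φ, hsep, hsm, hemb, hJ, hach, hnorm⟩

/-- Repair B from the registered stub by name (`sorry` only inside `stub_repairA`). -/
theorem repairB_of_stubs : ThriftyClusterSettlingRepairB :=
  repairB_of_repairA repairA_of_stubs

end Summit.FinalStateConjecture.FinalStateConjecture.Cruxes.ThriftyClusterSettling.Registered

end
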